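import Literature.NumberTheory.LFunctions.DirichletLTruncationPackedSound
import Literature.NumberTheory.LFunctions.FeketePolyaKernelCertificatesWeightedWrappers
import HarnessLib

/-!
# Packed truncation certificates — per-kind wrappers

From the residue tables of the odd prime factors (`plainTabsC kind b 47 ps q`), a parity test or a packed truncation certificate
(frame on the union of the cell groups + every group) gives `L(σ, χ) ≠ 0` on `(0, 1)` for the primitive quadratic character of
conductor `q` (odd `q = ∏ ps`, kind `0`; `q = 4·∏ ps`, kind `1`). [cite: Chua2005RealZeros, §2.2 ALGO 1]
-/

namespace Literature.NumberTheory.LFunctions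

namespace LTruncationPacked

open Finset FeketePolyaKernel LTruncationCert PrimitiveQuadratic Literature.Analysis.Convolution

/-- Parity of a product of odd numbers. [folklore] -/
private theorem prod_mod_two₄ : ∀ (ps : List ℕ), (∀ p ∈ ps, p % 2 = 1) → ps.prod % 2 = 1
  | [], _ => rfl
  | p :: rest, h => by
    rw [List.prod_cons, Nat.mul_mod, h p (by simp), prod_mod_two₄ rest fun p' hp' ↦ h p' (by simp [hp'])]

/-- All entries of the factor list are odd primes. [folklore] -/
private theorem odd_of_forall₄ {ps : List ℕ} (hps : ps.Forall fun p ↦ p.Prime ∧ p ≠ 2) :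
    (∀ p ∈ ps, p % 2 = 1) ∧ (∀ p ∈ ps, 1 ≤ p) := by
  rw [List.forall_iff_forall_mem] at hps
  exact ⟨fun p hp ↦ (hps p hp).1.eq_two_or_odd.resolve_left (hps p hp).2, fun p hp => (hps p hp).1.one_lt.le⟩

/-- **Even characters, odd conductor `q = ∏ ps`** (kind `0`): parity test or packed truncation certificate.
[cite: Chua2005RealZeros, §2.2 ALGO 1] -/
theorem good_even_of_odd_T {q : ℕ} [NeZero q] (ps : List ℕ) (hps : ps.Forall fun p ↦ p.Prime ∧ p ≠ 2)
    (hprod : ps.prod = q) (hq1 : 1 < q) (b e P J G K Bm : ℕ) (hb : 48 ≤ b) (groups : List (List (ℕ × ℕ)))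
    (hne : groups ≠ [])
    (h : valOddR (resTable ps) (q - 1) = -1 ∨
      (certTframe b e J q Bm groups.flatten (plainTabsC 0 b 47 ps q) = true ∧
        ∀ g ∈ groups, certTcells b P J G q K Bm g (plainTabsC 0 b 47 ps q) = true)) :
    ∀ χ : DirichletCharacter ℂ q, χ.IsQuadratic → χ.IsPrimitive → χ.Even →
      ∀ σ : ℝ, 0 < σ → σ < 1 → χ.LFunction σ ≠ 0 := by
  obtain ⟨hodd, hps1⟩ := odd_of_forall₄ hps
  have hq2 : q % 2 = 1 := hprod ▸ prod_mod_two₄ ps hodd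
  intro χ hquad hprim hpar
  have hv : ∀ n : ℕ, (χ (n : ZMod q)).re = valOddR (resTable ps) n := fun n ↦ by
    rw [valOddR_eq hps hprod hq1, re_apply_eq_valOdd (Nat.odd_iff.mpr hq2) hq1 hprim hquad]
  rcases h with hp | ⟨hframe, hcells⟩
  · exact fun σ _ _ => (not_even_of_val _ hv hp hpar).elim
  · have hv' : ∀ n : ℕ, (χ (n : ZMod q)).re = plainVal 0 (resTable ps) n := fun n => by rw [hv]; rfl
    have htab : IsSignTab b q (plainVal 0 (resTable ps)) (plainTabsC 0 b 47 ps q) :=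
      isSignTab_plainTabsC (by omega) (by norm_num) (by omega) ps
        (fun p hp => ⟨hps1 p hp, hprod ▸ List.dvd_prod hp⟩) (by simp [kindPeriod])
    exact lfunction_ne_zero_of_certT hprim hquad hv' htab groups hne hframe hcells

/-- **Even characters, conductor `4m`, `m = ∏ ps`** (kind `1`): parity test or packed truncation certificate.
[cite: Chua2005RealZeros, §2.2 ALGO 1] -/
theorem good_even_of_four_T {q : ℕ} [NeZero q] (ps : List ℕ) (hps : ps.Forall fun p ↦ p.Prime ∧ p ≠ 2)
    (hprod : 4 * ps.prod = q) (hq1 : 4 < q) (b e P J G K Bm : ℕ) (hb : 48 ≤ b) (groups : List (List (ℕ × ℕ)))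
    (hne : groups ≠ [])
    (h : valFourR (resTable ps) (q - 1) = -1 ∨
      (certTframe b e J q Bm groups.flatten (plainTabsC 1 b 47 ps q) = true ∧
        ∀ g ∈ groups, certTcells b P J G q K Bm g (plainTabsC 1 b 47 ps q) = true)) :
    ∀ χ : DirichletCharacter ℂ q, χ.IsQuadratic → χ.IsPrimitive → χ.Even →
      ∀ σ : ℝ, 0 < σ → σ < 1 → χ.LFunction σ ≠ 0 := by
  obtain ⟨hodd, hps1⟩ := odd_of_forall₄ hps
  subst hprod
  set m := ps.prod with hm
  haveI : NeZero m := ⟨by omega⟩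
  have hm2 : m % 2 = 1 := prod_mod_two₄ ps hodd
  intro χ hquad hprim hpar
  have hv : ∀ n : ℕ, (χ (n : ZMod (2 ^ 2 * m))).re = valFourR (resTable ps) n := fun n ↦ by
    rw [valFourR_eq hps hm.symm (by omega), re_apply_eq_valFour (m := m) (Nat.odd_iff.mpr hm2) (by omega)
      hprim hquad]
  rcases h with hp | ⟨hframe, hcells⟩
  · exact fun σ _ _ => (not_even_of_val _ hv hp hpar).elim
  · have hv' : ∀ n : ℕ, (χ (n : ZMod (4 * m))).re = plainVal 1 (resTable ps) n := fun n => by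
      rw [show plainVal 1 (resTable ps) n = valFourR (resTable ps) n from rfl]; exact hv n
    have htab : IsSignTab b (4 * m) (plainVal 1 (resTable ps)) (plainTabsC 1 b 47 ps (4 * m)) :=
      isSignTab_plainTabsC (by omega) (by norm_num) (by omega) ps
        (fun p hp => ⟨hps1 p hp, Dvd.dvd.mul_left (hm ▸ List.dvd_prod hp) 4⟩) (by simp [kindPeriod])
    exact lfunction_ne_zero_of_certT hprim hquad hv' htab groups hne hframe hcells

/-- **Odd characters, odd conductor `q = ∏ ps`** (kind `0`): parity test or packed truncation certificate.
[cite: Chua2005RealZeros, §2.2 ALGO 1] -/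
theorem good_odd_of_odd_T {q : ℕ} [NeZero q] (ps : List ℕ) (hps : ps.Forall fun p ↦ p.Prime ∧ p ≠ 2)
    (hprod : ps.prod = q) (hq1 : 1 < q) (b e P J G K Bm : ℕ) (hb : 48 ≤ b) (groups : List (List (ℕ × ℕ)))
    (hne : groups ≠ [])
    (h : valOddR (resTable ps) (q - 1) = 1 ∨
      (certTframe b e J q Bm groups.flatten (plainTabsC 0 b 47 ps q) = true ∧
        ∀ g ∈ groups, certTcells b P J G q K Bm g (plainTabsC 0 b 47 ps q) = true)) :
    ∀ χ : DirichletCharacter ℂ q, χ.IsQuadratic → χ.IsPrimitive → χ.Odd →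
      ∀ σ : ℝ, 0 < σ → σ < 1 → χ.LFunction σ ≠ 0 := by
  obtain ⟨hodd, hps1⟩ := odd_of_forall₄ hps
  have hq2 : q % 2 = 1 := hprod ▸ prod_mod_two₄ ps hodd
  intro χ hquad hprim hpar
  have hv : ∀ n : ℕ, (χ (n : ZMod q)).re = valOddR (resTable ps) n := fun n ↦ by
    rw [valOddR_eq hps hprod hq1, re_apply_eq_valOdd (Nat.odd_iff.mpr hq2) hq1 hprim hquad]
  rcases h with hp | ⟨hframe, hcells⟩
  · exact fun σ _ _ => (OddSmallModuliII.not_odd_of_val _ hv hp hpar).elim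
  · have hv' : ∀ n : ℕ, (χ (n : ZMod q)).re = plainVal 0 (resTable ps) n := fun n => by rw [hv]; rfl
    have htab : IsSignTab b q (plainVal 0 (resTable ps)) (plainTabsC 0 b 47 ps q) :=
      isSignTab_plainTabsC (by omega) (by norm_num) (by omega) ps
        (fun p hp => ⟨hps1 p hp, hprod ▸ List.dvd_prod hp⟩) (by simp [kindPeriod])
    exact lfunction_ne_zero_of_certT hprim hquad hv' htab groups hne hframe hcells

/-- **Odd characters, conductor `4m`, `m = ∏ ps`** (kind `1`): parity test or packed truncation certificate.
[cite: Chua2005RealZeros, §2.2 ALGO 1] -/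
theorem good_odd_of_four_T {q : ℕ} [NeZero q] (ps : List ℕ) (hps : ps.Forall fun p ↦ p.Prime ∧ p ≠ 2)
    (hprod : 4 * ps.prod = q) (hq1 : 4 < q) (b e P J G K Bm : ℕ) (hb : 48 ≤ b) (groups : List (List (ℕ × ℕ)))
    (hne : groups ≠ [])
    (h : valFourR (resTable ps) (q - 1) = 1 ∨
      (certTframe b e J q Bm groups.flatten (plainTabsC 1 b 47 ps q) = true ∧
        ∀ g ∈ groups, certTcells b P J G q K Bm g (plainTabsC 1 b 47 ps q) = true)) :
    ∀ χ : DirichletCharacter ℂ q, χ.IsQuadratic → χ.IsPrimitive → χ.Odd →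
      ∀ σ : ℝ, 0 < σ → σ < 1 → χ.LFunction σ ≠ 0 := by
  obtain ⟨hodd, hps1⟩ := odd_of_forall₄ hps
  subst hprod
  set m := ps.prod with hm
  haveI : NeZero m := ⟨by omega⟩
  have hm2 : m % 2 = 1 := prod_mod_two₄ ps hodd
  intro χ hquad hprim hpar
  have hv : ∀ n : ℕ, (χ (n : ZMod (2 ^ 2 * m))).re = valFourR (resTable ps) n := fun n ↦ by
    rw [valFourR_eq hps hm.symm (by omega), re_apply_eq_valFour (m := m) (Nat.odd_iff.mpr hm2) (by omega)
      hprim hquad]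
  rcases h with hp | ⟨hframe, hcells⟩
  · exact fun σ _ _ => (OddSmallModuliII.not_odd_of_val _ hv hp hpar).elim
  · have hv' : ∀ n : ℕ, (χ (n : ZMod (4 * m))).re = plainVal 1 (resTable ps) n := fun n => by
      rw [show plainVal 1 (resTable ps) n = valFourR (resTable ps) n from rfl]; exact hv n
    have htab : IsSignTab b (4 * m) (plainVal 1 (resTable ps)) (plainTabsC 1 b 47 ps (4 * m)) :=
      isSignTab_plainTabsC (by omega) (by norm_num) (by omega) ps
        (fun p hp => ⟨hps1 p hp, Dvd.dvd.mul_left (hm ▸ List.dvd_prod hp) 4⟩) (by simp [kindPeriod])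
    exact lfunction_ne_zero_of_certT hprim hquad hv' htab groups hne hframe hcells

end LTruncationPacked

end Literature.NumberTheory.LFunctions
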